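import Literature.Probability.LatticeModels.CriticalTwoPointBounds
import Literature.Probability.LatticeModels.ConformalCovariance
import Mathlib.Analysis.Asymptotics.SpecificAsymptotics
import HarnessLib

/-!
# `1/2 ≤ Δ ≤ 1` for the scaling dimension of the critical 3D Ising spin, from the two-point bounds

Trunk G02 (T-STATMECH), topic `Probability/LatticeModels`, namespace `Literature.CritIsing`.
Theorem-only file. The second named fact of inventory item crit-ising.S10 (`Sharpness.lean`),
`Literature.Probability.LatticeModels.scalingDimension_mem_Icc` — "if the critical correlators of the three-dimensional
Ising model admit a pointwise scaling limit `S` with renormalisation `ρ > 0` on `(0,1]`, and `S` is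
scale-covariant with scaling dimension `Δ` and has a non-degenerate two-point function, then
`1/2 ≤ Δ ≤ 1`" — is **proved from the first one**, `criticalTwoPoint_bounds`
(`c‖x‖⁻² ≤ ⟨σ₀σ_x⟩⁺_{β_c} ≤ C‖x‖⁻¹` on `ℤ³`; Duminil-Copin 2019, Thm. 4.8 / ICM 2022, §1), by
the elementary argument indicated in its docstring:

1. Along the meshes `δ_k = 2^{-(k+1)}` the lattice points `[e/δ_k] = 2^{k+1}e₁`,
   `[2e/δ_k] = 2^{k+2}e₁ = [e/δ_{k+1}]` are exact (`latticeApprox_unitVec`), so the scaling limit at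
   the two non-coincident configurations `(0, e)`, `(0, 2e)` reads
   `ρ(δ_k)² ⟨σ₀σ_{2^{k+1}e₁}⟩ → S₂(0,e)` and `ρ(δ_k)² ⟨σ₀σ_{2^{k+2}e₁}⟩ → S₂(0,2e) = 2^{-2Δ}S₂(0,e)`
   (scale covariance), whence `ρ(δ_k)²/ρ(δ_{k+1})² → 2^{-2Δ}` (`tendsto_rho_sq_ratio`);
2. hence `log ρ(δ_k)² / k → 2Δ log 2` (Cesàro on the telescoping differences,
   `tendsto_log_rho_sq_div`);
3. the two-point bounds at `‖2^{k+1}e₁‖ = 2^{k+1}` squeeze `log ρ(δ_k)²` between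
   `(k+1) log 2 + O(1)` and `2(k+1) log 2 + O(1)`, so `log 2 ≤ 2Δ log 2 ≤ 2 log 2`.

Results: `scalingDimension_mem_Icc_of_bounds : criticalTwoPoint_bounds → scalingDimension_mem_Icc`,
and — the whole infrared/lower-bound side being theorems (`CriticalTwoPointBounds.lean`) —
`scalingDimension_mem_Icc_of_exitProb` from the single deep random-current fact
`ads_exitProb_tendsto_zero_of_lroTildeSq`.

## Mathlib status

Anchors: `TendstoLocallyUniformlyOn.tendsto_at`, `Filter.Tendsto.cesaro`, `Finset.sum_range_sub`,
`Real.log`, `Filter.Tendsto.log`, `tendsto_nhdsWithin_iff`, `EuclideanSpace.single`,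
`Int.floor_intCast`, `Real.rpow_natCast`/`Real.rpow_neg`; tree: `criticalTwoPoint_bounds`,
`scalingDimension_mem_Icc`, `HasPointwiseScalingLimit`, `rescaledCorrelator`, `latticeApprox`,
`IsScaleCovariant`, `IsNondegenerateTwoPoint`, `criticalCorr_two`, `Site.norm_eq_supNorm`.
-/

noncomputable section

open Filter Topology Literature.Probability.LatticeModels Literature.Probability.Percolation

namespace Literature.Probability.LatticeModels

/-! ### The dyadic meshes and the lattice points along the first axis -/

/-- The dyadic meshes `δ_k = 2^{-(k+1)} ∈ (0, 1/2]`. [folklore] -/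
theorem dyadicMesh_pos (k : ℕ) : (0 : ℝ) < (2 : ℝ)⁻¹ ^ (k + 1) := by positivity

/-- `δ_k ≤ 1`. [folklore] -/
theorem dyadicMesh_le_one (k : ℕ) : (2 : ℝ)⁻¹ ^ (k + 1) ≤ 1 :=
  pow_le_one₀ (by norm_num) (by norm_num)

/-- `δ_k → 0⁺`. [folklore] -/
theorem tendsto_dyadicMesh :
    Tendsto (fun k : ℕ => (2 : ℝ)⁻¹ ^ (k + 1)) atTop (𝓝[>] (0 : ℝ)) := by
  rw [tendsto_nhdsWithin_iff]
  refine ⟨?_, Filter.Eventually.of_forall fun k => dyadicMesh_pos k⟩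
  have h := (tendsto_pow_atTop_nhds_zero_of_lt_one (by norm_num : (0 : ℝ) ≤ 2⁻¹)
    (by norm_num : (2 : ℝ)⁻¹ < 1)).comp (tendsto_add_atTop_nat 1)
  exact h

/-- The unit vector `e = e₀` of `ℝ³`. [folklore] -/
theorem unitVec_apply (t : ℝ) (i : Fin 3) :
    (EuclideanSpace.single (0 : Fin 3) t : EuclideanSpace ℝ (Fin 3)) i = if i = 0 then t else 0 := by
  simp

/-- **Exact lattice points**: `[t e / δ_k] = (t 2^{k+1}) e₁` for `t ∈ ℕ`
(`latticeApprox δ x = (⌊x_i/δ⌋)_i`). [folklore] -/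
theorem latticeApprox_dyadic_unitVec (k t : ℕ) :
    latticeApprox ((2 : ℝ)⁻¹ ^ (k + 1)) (EuclideanSpace.single (0 : Fin 3) (t : ℝ)) =
      Pi.single (0 : Fin 3) ((t : ℤ) * 2 ^ (k + 1)) := by
  funext i
  rw [latticeApprox_apply, unitVec_apply]
  by_cases hi : i = 0
  · subst hi
    rw [if_pos rfl, Pi.single_eq_same]
    have h : (t : ℝ) / (2 : ℝ)⁻¹ ^ (k + 1) = (((t : ℤ) * 2 ^ (k + 1) : ℤ) : ℝ) := by
      rw [inv_pow, div_inv_eq_mul]; push_cast; ring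
    rw [h, Int.floor_intCast]
  · rw [if_neg hi, Pi.single_eq_of_ne hi, zero_div, Int.floor_zero]

/-- `[0/δ] = 0`. [folklore] -/
theorem latticeApprox_zero (δ : ℝ) : latticeApprox δ (0 : EuclideanSpace ℝ (Fin 3)) = 0 := by
  funext i; simp [latticeApprox_apply]

/-- The sup norm of `m e₁ ∈ ℤ³` is `|m|`. [folklore] -/
theorem norm_single_axis (m : ℤ) : ‖(Pi.single (0 : Fin 3) m : Site 3)‖ = |(m : ℝ)| := by
  rw [Site.norm_eq_supNorm]
  have h : Site.supNorm (Pi.single (0 : Fin 3) m : Site 3) = m.natAbs := by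
    apply le_antisymm
    · rw [Site.supNorm_le_iff]
      intro j
      by_cases hj : j = 0
      · subst hj; simp
      · rw [Pi.single_eq_of_ne hj]; simp
    · have := Site.natAbs_le_supNorm (Pi.single (0 : Fin 3) m : Site 3) 0
      simpa using this
  rw [h, Nat.cast_natAbs, Int.cast_abs]

/-- The configurations `(0, t e)`, `t ≠ 0`, are non-coincident. [folklore] -/
theorem zero_unitVec_mem_nonCoincident {t : ℝ} (ht : t ≠ 0) :
    (![0, EuclideanSpace.single (0 : Fin 3) t] : Fin 2 → EuclideanSpace ℝ (Fin 3)) ∈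
      NonCoincident 3 2 := by
  rw [mem_nonCoincident]
  intro i j hij
  fin_cases i <;> fin_cases j
  · rfl
  · exfalso
    have h := congrArg (fun v : EuclideanSpace ℝ (Fin 3) => v 0) hij
    simp at h
    exact ht h.symm
  · exfalso
    have h := congrArg (fun v : EuclideanSpace ℝ (Fin 3) => v 0) hij
    simp at h
    exact ht h
  · rfl

/-- The rescaled critical two-point correlator at `(0, t e)` along the dyadic meshes:
`ρ(δ_k)² ⟨σ₀σ_{t2^{k+1}e₁}⟩⁺_{β_c}`. [folklore] -/
theorem rescaledCorrelator_criticalCorr_dyadic (ρ : ℝ → ℝ) (k t : ℕ) :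
    rescaledCorrelator (criticalCorr 3) ρ 2 ((2 : ℝ)⁻¹ ^ (k + 1))
        ![0, EuclideanSpace.single (0 : Fin 3) (t : ℝ)] =
      ρ ((2 : ℝ)⁻¹ ^ (k + 1)) ^ 2 *
        criticalTwoPoint 3 (Pi.single (0 : Fin 3) ((t : ℤ) * 2 ^ (k + 1))) := by
  rw [rescaledCorrelator_apply, ← criticalCorr_two]
  congr 1
  congr 1
  funext i
  fin_cases i
  · simp [latticeApprox_zero]
  · simpa using latticeApprox_dyadic_unitVec k t

/-! ### Step 1: `ρ(δ_k)²/ρ(δ_{k+1})² → 2^{-2Δ}` -/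

section Limit

variable {ρ : ℝ → ℝ} {Δ : ℝ} {S : CorrFamily 3}

/-- Pointwise convergence at `(0, t e)` along the dyadic meshes:
`ρ(δ_k)² ⟨σ₀σ_{t2^{k+1}e₁}⟩ → S₂(0, t e)` for `t ∈ ℕ`, `t ≠ 0`. [folklore] -/
theorem tendsto_rescaled_dyadic (hlim : HasPointwiseScalingLimit (criticalCorr 3) ρ S) {t : ℕ}
    (ht : t ≠ 0) :
    Tendsto (fun k : ℕ => ρ ((2 : ℝ)⁻¹ ^ (k + 1)) ^ 2 *
        criticalTwoPoint 3 (Pi.single (0 : Fin 3) ((t : ℤ) * 2 ^ (k + 1)))) atTop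
      (𝓝 (S 2 ![0, EuclideanSpace.single (0 : Fin 3) (t : ℝ)])) := by
  have h := (hlim 2).tendsto_at (zero_unitVec_mem_nonCoincident (t := (t : ℝ))
    (by exact_mod_cast ht))
  have h2 := h.comp tendsto_dyadicMesh
  refine h2.congr fun k => ?_
  simp only [Function.comp_apply]
  exact rescaledCorrelator_criticalCorr_dyadic ρ k t

/-- Scale covariance at the pair `(0,e) ↦ (0,2e)`: `S₂(0, 2e) = 2^{-2Δ} S₂(0, e)`. [folklore] -/
theorem S_two_unitVec_eq (hsc : IsScaleCovariant Δ S) :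
    S 2 ![0, EuclideanSpace.single (0 : Fin 3) ((2 : ℕ) : ℝ)] =
      (2 : ℝ) ^ (-(2 : ℝ) * Δ) * S 2 ![0, EuclideanSpace.single (0 : Fin 3) ((1 : ℕ) : ℝ)] := by
  have h := hsc 2 2 (by norm_num) ![0, EuclideanSpace.single (0 : Fin 3) ((1 : ℕ) : ℝ)]
  have hcfg : (fun i => (2 : ℝ) • (![0, EuclideanSpace.single (0 : Fin 3) ((1 : ℕ) : ℝ)] :
      Fin 2 → EuclideanSpace ℝ (Fin 3)) i) = ![0, EuclideanSpace.single (0 : Fin 3) ((2 : ℕ) : ℝ)] := by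
    funext i
    fin_cases i
    · simp
    · simp only [Nat.cast_ofNat, Fin.mk_one, Matrix.cons_val_one, Matrix.cons_val_fin_one,
        Nat.cast_one]
      ext j
      simp
  rw [hcfg] at h
  rw [h]
  norm_num

/-- **`ρ(δ_k)² / ρ(δ_{k+1})² → 2^{-2Δ}`** ("scale covariance and convergence give
`ρ(δ)/ρ(δ/2) → 2^{-Δ}`", docstring of `scalingDimension_mem_Icc`): both `ρ(δ_k)²⟨σ₀σ_{2^{k+2}e₁}⟩`
and `ρ(δ_{k+1})²⟨σ₀σ_{2^{k+2}e₁}⟩` converge, to `S₂(0,2e) = 2^{-2Δ}S₂(0,e)` and `S₂(0,e) > 0`. [folklore] -/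
theorem tendsto_rho_sq_ratio (hlim : HasPointwiseScalingLimit (criticalCorr 3) ρ S)
    (hsc : IsScaleCovariant Δ S) (hnd : IsNondegenerateTwoPoint S) :
    Tendsto (fun k : ℕ => ρ ((2 : ℝ)⁻¹ ^ (k + 1)) ^ 2 / ρ ((2 : ℝ)⁻¹ ^ (k + 1 + 1)) ^ 2) atTop
      (𝓝 ((2 : ℝ) ^ (-(2 : ℝ) * Δ))) := by
  set s₁ := S 2 ![0, EuclideanSpace.single (0 : Fin 3) ((1 : ℕ) : ℝ)] with hs₁
  have hs₁pos : 0 < s₁ := hnd _ (zero_unitVec_mem_nonCoincident (by norm_num))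
  -- numerator sequence: `ρ(δ_k)² G(2^{k+2}e₁) → S₂(0,2e)`
  have hnum := tendsto_rescaled_dyadic hlim (t := 2) two_ne_zero
  rw [S_two_unitVec_eq hsc] at hnum
  -- denominator sequence: `ρ(δ_{k+1})² G(2^{k+2}e₁) → s₁`
  have hden := (tendsto_rescaled_dyadic hlim (t := 1) one_ne_zero).comp (tendsto_add_atTop_nat 1)
  have heq : ∀ k : ℕ, ((2 : ℕ) : ℤ) * 2 ^ (k + 1) = ((1 : ℕ) : ℤ) * 2 ^ (k + 1 + 1) := by
    intro k; push_cast; ring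
  have hden' : Tendsto (fun k : ℕ => ρ ((2 : ℝ)⁻¹ ^ (k + 1 + 1)) ^ 2 *
      criticalTwoPoint 3 (Pi.single (0 : Fin 3) (((2 : ℕ) : ℤ) * 2 ^ (k + 1)))) atTop (𝓝 s₁) := by
    refine hden.congr fun k => ?_
    simp only [Function.comp_apply, heq k]
  -- the ratio
  have hratio := hnum.div hden' hs₁pos.ne'
  rw [mul_div_assoc, div_self hs₁pos.ne', mul_one] at hratio
  refine hratio.congr' ?_
  -- eventually the correlator is nonzero (it is positive for large `k` since the limit `s₁ > 0`)
  have hev : ∀ᶠ k : ℕ in atTop, ρ ((2 : ℝ)⁻¹ ^ (k + 1 + 1)) ^ 2 *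
      criticalTwoPoint 3 (Pi.single (0 : Fin 3) (((2 : ℕ) : ℤ) * 2 ^ (k + 1))) ≠ 0 :=
    hden'.eventually_ne hs₁pos.ne'
  filter_upwards [hev] with k hk
  have hG : criticalTwoPoint 3 (Pi.single (0 : Fin 3) (((2 : ℕ) : ℤ) * 2 ^ (k + 1))) ≠ 0 :=
    fun h => hk (by rw [h, mul_zero])
  simp only [Pi.div_apply]
  rw [mul_div_mul_right _ _ hG]

/-! ### Step 2: `log ρ(δ_k)² / k → 2Δ log 2` -/

/-- Eventually `ρ(δ_k)² ≠ 0` along the relevant subsequence is automatic from `ρ > 0` on `(0,1]`;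
the logarithmic increments converge: `log ρ(δ_{k+1})² - log ρ(δ_k)² → 2Δ log 2`. [folklore] -/
theorem tendsto_log_rho_sq_sub (hlim : HasPointwiseScalingLimit (criticalCorr 3) ρ S)
    (hsc : IsScaleCovariant Δ S) (hnd : IsNondegenerateTwoPoint S)
    (hρ : ∀ δ ∈ Set.Ioc (0 : ℝ) 1, 0 < ρ δ) :
    Tendsto (fun k : ℕ => Real.log (ρ ((2 : ℝ)⁻¹ ^ (k + 1 + 1)) ^ 2) -
        Real.log (ρ ((2 : ℝ)⁻¹ ^ (k + 1)) ^ 2)) atTop (𝓝 (2 * Δ * Real.log 2)) := by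
  have hρk : ∀ k : ℕ, 0 < ρ ((2 : ℝ)⁻¹ ^ (k + 1)) := fun k =>
    hρ _ ⟨dyadicMesh_pos k, dyadicMesh_le_one k⟩
  have h := (tendsto_rho_sq_ratio hlim hsc hnd).log (by positivity)
  have hlog2 : Real.log ((2 : ℝ) ^ (-(2 : ℝ) * Δ)) = -(2 * Δ * Real.log 2) := by
    rw [Real.log_rpow (by norm_num)]; ring
  rw [hlog2] at h
  have h' := h.neg
  rw [neg_neg] at h'
  refine h'.congr fun k => ?_
  rw [Real.log_div (pow_ne_zero _ (hρk k).ne') (pow_ne_zero _ (hρk (k + 1)).ne')]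
  ring

/-- **`log ρ(δ_k)² / k → 2Δ log 2`** (Cesàro average of the telescoping increments). [folklore] -/
theorem tendsto_log_rho_sq_div (hlim : HasPointwiseScalingLimit (criticalCorr 3) ρ S)
    (hsc : IsScaleCovariant Δ S) (hnd : IsNondegenerateTwoPoint S)
    (hρ : ∀ δ ∈ Set.Ioc (0 : ℝ) 1, 0 < ρ δ) :
    Tendsto (fun k : ℕ => Real.log (ρ ((2 : ℝ)⁻¹ ^ (k + 1)) ^ 2) / k) atTop
      (𝓝 (2 * Δ * Real.log 2)) := by
  set u : ℕ → ℝ := fun k => Real.log (ρ ((2 : ℝ)⁻¹ ^ (k + 1)) ^ 2) with hu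
  have hces := (tendsto_log_rho_sq_sub hlim hsc hnd hρ).cesaro
  -- `∑_{i<k} (u (i+1) - u i) = u k - u 0`
  have htel : ∀ k : ℕ, ∑ i ∈ Finset.range k, (u (i + 1) - u i) = u k - u 0 :=
    fun k => Finset.sum_range_sub u k
  have h1 : Tendsto (fun k : ℕ => (k : ℝ)⁻¹ * (u k - u 0)) atTop (𝓝 (2 * Δ * Real.log 2)) := by
    refine hces.congr fun k => ?_
    simp only [hu] at htel ⊢
    rw [htel k]
  have h2 : Tendsto (fun k : ℕ => (k : ℝ)⁻¹ * u 0) atTop (𝓝 0) := by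
    have := tendsto_inv_atTop_zero.comp (tendsto_natCast_atTop_atTop (R := ℝ))
    simpa using this.mul_const (u 0)
  have h3 := h1.add h2
  rw [add_zero] at h3
  refine h3.congr fun k => ?_
  simp only [hu]
  ring

end Limit

/-! ### Step 3: the two-point bounds pin `Δ` -/

/-- **`criticalTwoPoint_bounds ⇒ scalingDimension_mem_Icc`** (the elementary argument recorded in
the docstring of `scalingDimension_mem_Icc`, `Sharpness.lean`; Simon 1980 / Lieb 1980 lower bound,
Fröhlich–Simon–Spencer 1976 upper bound, as summarised in Duminil-Copin, ICM 2022, §1): the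
two-sided power-law bounds on `⟨σ₀σ_x⟩⁺_{β_c}` in `d = 3` force the scaling dimension of any
scale-covariant non-degenerate pointwise scaling limit of the critical correlators to lie in
`[1/2, 1]`. [cite: DuminilCopin2019, Thm. 4.8, §4.4] -/
theorem scalingDimension_mem_Icc_of_bounds (hb : criticalTwoPoint_bounds (d := 3)) :
    scalingDimension_mem_Icc := by
  intro ρ Δ S hlim hsc hnd hρ
  obtain ⟨c, C, hc, hbd⟩ := hb le_rfl
  -- notation
  set δ : ℕ → ℝ := fun k => (2 : ℝ)⁻¹ ^ (k + 1) with hδ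
  set x : ℕ → Site 3 := fun k => Pi.single (0 : Fin 3) (((1 : ℕ) : ℤ) * 2 ^ (k + 1)) with hx
  set G : ℕ → ℝ := fun k => criticalTwoPoint 3 (x k) with hG
  set r : ℕ → ℝ := fun k => ρ (δ k) ^ 2 * G k with hr
  set s₁ := S 2 ![0, EuclideanSpace.single (0 : Fin 3) ((1 : ℕ) : ℝ)] with hs₁
  have hs₁pos : 0 < s₁ := hnd _ (zero_unitVec_mem_nonCoincident (by norm_num))
  have hρk : ∀ k : ℕ, 0 < ρ (δ k) := fun k => hρ _ ⟨dyadicMesh_pos k, dyadicMesh_le_one k⟩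
  -- the norm of `x k` is `2^{k+1}`
  have hxne : ∀ k, x k ≠ 0 := by
    intro k h
    have := congrFun h 0
    simp [hx] at this
  have hnorm : ∀ k, (‖x k‖ : ℝ) = 2 ^ (k + 1) := by
    intro k
    rw [hx, norm_single_axis]
    push_cast
    rw [one_mul, abs_of_pos (by positivity)]
  -- the two-point bounds at `x k`: `c 4^{-(k+1)} ≤ G k ≤ C 2^{-(k+1)}`
  have hrpow2 : ∀ k : ℕ, ((2 ^ (k + 1) : ℝ)) ^ (-(((3 : ℕ) : ℝ) - 1)) = ((2 ^ (k + 1) : ℝ) ^ 2)⁻¹ := by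
    intro k
    rw [show (-(((3 : ℕ) : ℝ) - 1)) = -((2 : ℕ) : ℝ) by norm_num, Real.rpow_neg (by positivity),
      Real.rpow_natCast]
  have hrpow1 : ∀ k : ℕ, ((2 ^ (k + 1) : ℝ)) ^ (-(((3 : ℕ) : ℝ) - 2)) = ((2 ^ (k + 1) : ℝ))⁻¹ := by
    intro k
    rw [show (-(((3 : ℕ) : ℝ) - 2)) = -((1 : ℕ) : ℝ) by norm_num, Real.rpow_neg (by positivity),
      Real.rpow_natCast, pow_one]
  have hlow : ∀ k, c * ((2 ^ (k + 1) : ℝ) ^ 2)⁻¹ ≤ G k := by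
    intro k
    have h := (hbd (x k) (hxne k)).1
    rw [hnorm k, hrpow2 k] at h
    exact h
  have hupp : ∀ k, G k ≤ C * ((2 ^ (k + 1) : ℝ))⁻¹ := by
    intro k
    have h := (hbd (x k) (hxne k)).2
    rw [hnorm k, hrpow1 k] at h
    exact h
  have hGpos : ∀ k, 0 < G k := fun k =>
    lt_of_lt_of_le (mul_pos hc (by positivity)) (hlow k)
  have hCpos : 0 < C := by
    have h := (hGpos 0).trans_le (hupp 0)
    have : (0 : ℝ) < ((2 ^ (0 + 1) : ℝ))⁻¹ := by positivity
    nlinarith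
  -- `r k → s₁ > 0`, hence eventually `s₁/2 ≤ r k ≤ 2 s₁`
  have hrlim : Tendsto r atTop (𝓝 s₁) := tendsto_rescaled_dyadic hlim (t := 1) one_ne_zero
  have hr_ev : ∀ᶠ k in atTop, s₁ / 2 ≤ r k ∧ r k ≤ 2 * s₁ := by
    have h1 : ∀ᶠ k in atTop, s₁ / 2 < r k := hrlim.eventually_const_lt (by linarith)
    have h2 : ∀ᶠ k in atTop, r k < 2 * s₁ := hrlim.eventually_lt_const (by linarith)
    filter_upwards [h1, h2] with k h1 h2 using ⟨h1.le, h2.le⟩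
  -- the main limit `log ρ(δ_k)² / k → 2Δ log 2`
  have hmain := tendsto_log_rho_sq_div hlim hsc hnd hρ
  have hlog2 : 0 < Real.log 2 := Real.log_pos (by norm_num)
  -- `log ρ(δ_k)² = log r k - log G k`
  have hlogeq : ∀ k, Real.log (ρ (δ k) ^ 2) = Real.log (r k) - Real.log (G k) := by
    intro k
    rw [hr]
    simp only
    rw [Real.log_mul (pow_ne_zero _ (hρk k).ne') (hGpos k).ne']
    ring
  -- lower bound on the limit: `log 2 ≤ 2Δ log 2`
  have hpow1 : ∀ k : ℕ, Real.log (((2 ^ (k + 1) : ℝ))⁻¹) = -((k + 1 : ℝ) * Real.log 2) := by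
    intro k
    rw [Real.log_inv, Real.log_pow]; push_cast; ring
  have hpow2 : ∀ k : ℕ, Real.log (((2 ^ (k + 1) : ℝ) ^ 2)⁻¹) = -(2 * (k + 1 : ℝ) * Real.log 2) := by
    intro k
    rw [Real.log_inv, Real.log_pow, Real.log_pow]; push_cast; ring
  have hLB : ∀ᶠ k : ℕ in atTop,
      (Real.log (s₁ / 2) - Real.log C + (k + 1 : ℝ) * Real.log 2) / k ≤
        Real.log (ρ (δ k) ^ 2) / k := by
    filter_upwards [hr_ev, eventually_gt_atTop 0] with k hrk hk
    obtain ⟨hrk, -⟩ := hrk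
    have hk' : (0 : ℝ) < k := by exact_mod_cast hk
    rw [div_le_div_iff_of_pos_right hk', hlogeq k]
    -- `log G k ≤ log C - (k+1) log 2`
    have h1 : Real.log (G k) ≤ Real.log C + Real.log (((2 ^ (k + 1) : ℝ))⁻¹) := by
      rw [← Real.log_mul hCpos.ne' (by positivity)]
      exact Real.log_le_log (hGpos k) (hupp k)
    have h2 : Real.log (s₁ / 2) ≤ Real.log (r k) := Real.log_le_log (by positivity) hrk
    rw [hpow1 k] at h1
    linarith
  have hUB : ∀ᶠ k : ℕ in atTop,
      Real.log (ρ (δ k) ^ 2) / k ≤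
        (Real.log (2 * s₁) - Real.log c + 2 * (k + 1 : ℝ) * Real.log 2) / k := by
    filter_upwards [hr_ev, eventually_gt_atTop 0] with k hrk hk
    obtain ⟨hrk1, hrk⟩ := hrk
    have hk' : (0 : ℝ) < k := by exact_mod_cast hk
    rw [div_le_div_iff_of_pos_right hk', hlogeq k]
    have h1 : Real.log c + Real.log (((2 ^ (k + 1) : ℝ) ^ 2)⁻¹) ≤ Real.log (G k) := by
      rw [← Real.log_mul hc.ne' (by positivity)]
      exact Real.log_le_log (mul_pos hc (by positivity)) (hlow k)
    have h2 : Real.log (r k) ≤ Real.log (2 * s₁) := Real.log_le_log (by linarith) hrk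
    rw [hpow2 k] at h1
    linarith
  -- the comparison sequences converge to `log 2` and `2 log 2`
  have hinvk : Tendsto (fun k : ℕ => (k : ℝ)⁻¹) atTop (𝓝 0) :=
    tendsto_inv_atTop_zero.comp tendsto_natCast_atTop_atTop
  have hLBlim : Tendsto (fun k : ℕ => (Real.log (s₁ / 2) - Real.log C + (k + 1 : ℝ) * Real.log 2) / k)
      atTop (𝓝 (Real.log 2)) := by
    have h : ∀ k : ℕ, 0 < k → (Real.log (s₁ / 2) - Real.log C + (k + 1 : ℝ) * Real.log 2) / k =
        (Real.log (s₁ / 2) - Real.log C + Real.log 2) * (k : ℝ)⁻¹ + Real.log 2 := by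
      intro k hk
      have hk' : (k : ℝ) ≠ 0 := by exact_mod_cast hk.ne'
      field_simp
      ring
    have hl := (hinvk.const_mul (Real.log (s₁ / 2) - Real.log C + Real.log 2)).add_const (Real.log 2)
    rw [mul_zero, zero_add] at hl
    refine hl.congr' ?_
    filter_upwards [eventually_gt_atTop 0] with k hk using (h k hk).symm
  have hUBlim : Tendsto (fun k : ℕ => (Real.log (2 * s₁) - Real.log c + 2 * (k + 1 : ℝ) * Real.log 2) / k)
      atTop (𝓝 (2 * Real.log 2)) := by
    have h : ∀ k : ℕ, 0 < k → (Real.log (2 * s₁) - Real.log c + 2 * (k + 1 : ℝ) * Real.log 2) / k =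
        (Real.log (2 * s₁) - Real.log c + 2 * Real.log 2) * (k : ℝ)⁻¹ + 2 * Real.log 2 := by
      intro k hk
      have hk' : (k : ℝ) ≠ 0 := by exact_mod_cast hk.ne'
      field_simp
      ring
    have hl := (hinvk.const_mul (Real.log (2 * s₁) - Real.log c + 2 * Real.log 2)).add_const
      (2 * Real.log 2)
    rw [mul_zero, zero_add] at hl
    refine hl.congr' ?_
    filter_upwards [eventually_gt_atTop 0] with k hk using (h k hk).symm
  have hge : Real.log 2 ≤ 2 * Δ * Real.log 2 := le_of_tendsto_of_tendsto hLBlim hmain hLB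
  have hle : 2 * Δ * Real.log 2 ≤ 2 * Real.log 2 := le_of_tendsto_of_tendsto hmain hUBlim hUB
  constructor
  · nlinarith
  · nlinarith

/-- **`1/2 ≤ Δ ≤ 1` from the single deep random-current fact**: `scalingDimension_mem_Icc` follows
from `ads_exitProb_tendsto_zero_of_lroTildeSq` (through `criticalTwoPoint_bounds_of_exitProb`). [cite: DuminilCopin2019, Thm. 4.8, §4.4] -/
theorem scalingDimension_mem_Icc_of_exitProb
    (hexit : ads_exitProb_tendsto_zero_of_lroTildeSq (d := 3)) : scalingDimension_mem_Icc :=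
  scalingDimension_mem_Icc_of_bounds (criticalTwoPoint_bounds_of_exitProb hexit)

/-- **crit-ising.S10 on `ℤ³`, proved: `1/2 ≤ Δ ≤ 1`** — discharge of the named fact
`scalingDimension_mem_Icc` (`Sharpness.lean`): any scaling dimension `Δ` of a scale-covariant,
non-degenerate pointwise scaling limit (renormalisation `ρ > 0` on `(0, 1]`) of the critical
correlators of the three-dimensional Ising model lies in `[1/2, 1]`. From the reduction
`scalingDimension_mem_Icc_of_bounds` (this file) and the discharged two-point bounds
`criticalTwoPoint_bounds_holds` (`CriticalTwoPointBounds.lean`; Duminil-Copin 2019, Thm. 4.8: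
`c‖x‖⁻² ≤ ⟨σ₀σ_x⟩_{β_c} ≤ C‖x‖⁻¹` on `ℤ³` — lower bound Simon, CMP 77 (1980), Thm. 5.1 with Lieb
1980, upper bound the infrared bound of Fröhlich–Simon–Spencer 1976). [cite: DuminilCopin2019, Thm. 4.8, §4.4] -/
theorem scalingDimension_mem_Icc_holds : scalingDimension_mem_Icc :=
  scalingDimension_mem_Icc_of_bounds criticalTwoPoint_bounds_holds

end Literature.Probability.LatticeModels
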